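import Mathlib
import HarnessLib
import Summits.ResolutionOfSingularities.ResolutionOfSingularities.Theorems.WildQuotientsWildQuotientResolutionS1aTerminalReachLower

/-!
# S1a — KIRÁLY–LÜTKEBOHMERT AT MOVE 0: a global chart with PRINCIPAL AUGMENTATION IDEAL is TERMINAL (no move), and inhabits the research stub

[OURS · L1 W4.5c · leafhand-res-wildquotients-9 g1; SUCCESSOR-BRIEF-v2 §3 caveat E-T in its general form; DICTIONARY D-σ («kill criterion =
Király–Lütkebohmert: X^G Cartier ⇒ X/G regular»)] — NOT statements of the manuscript; counted 0; AI-level work, weaker than expert review. Crux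
stmt-ResolutionOfSingularities-17941 `CyclicQuotientFourfolds`, line `s1a-logminvertex` v13 (`stub_reachLowerInFX`). A CLASS of the research stub, not the stub.

The tree's GLOBAL Király–Lütkebohmert theorem ✓`InvariantsRegular.isRegularRing_invariantSubring` (`C` regular, `τ^[p] = id`, `augmentationIdeal τ`
principal, invariants Noetherian ⇒ `C^τ` regular) and E. Noether's finiteness ✓`InvariantsRegular.exists_finset_closure_of_finiteType`, combined with
the terminal recognition ✓`terminal_initial_of_fixedRing_equiv_regular` (`…S1aTerminalReachLower`), give the DEPTH-0 KILL in one line: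
* ★★ `terminal_initial_of_isPrincipal_augmentationIdeal` — action data with `X′` AFFINE, `q` affine, `G = ⟨g₀⟩`, a chart `e : Γ(X′, ⊤) ≃+* A₀` onto a
  REGULAR ring of finite type over a Noetherian ring `R₀` of `σ₀`-constants, intertwining `g₀` with a ring automorphism `σ₀` of order dividing the prime
  `p` whose AUGMENTATION IDEAL `(σ₀ a − a : a)` IS PRINCIPAL ⇒ the initial model is TERMINAL (its ring of invariants `A₀^{σ₀}` is regular);
* ★ `exists_reachLowerF_initial_of_isPrincipal_augmentationIdeal` — hence the conclusion of `ReachLowerInF(X)`, every root decoration (empty tree);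
* `terminal_initial_of_isPrincipal_augmentationIdeal_mvPolynomial` (+ `exists_reachLowerF_…`) — census coordinates `A₀ = k[x_ι]`, `R₀ = k`.
This subsumes, as far as TERMINALITY goes, the translation class (`augIdeal = (F)`, ✓`translation_terminal_initial`, which in addition identifies the
invariants with a POLYNOMIAL ring and needs no order hypothesis) and the principal rank-2 case (`augIdeal = (F, G) = (H)`,
✓`translationRankTwo_terminal_initial`); on a polynomial chart (a UFD) «locally principal» = «principal», so this is the complete depth-0 statement
for the initial model. What it does NOT cover is the game: data whose augmentation ideal is not principal need moves.
-/

set_option linter.dupNamespace false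

noncomputable section

open CategoryTheory Limits AlgebraicGeometry TopologicalSpace Topology MvPolynomial
open Literature.AlgebraicGeometry.Resolution Literature.AlgebraicGeometry.RelativeSpec
open Summit.ResolutionOfSingularities.ResolutionOfSingularities.Theorems.WildQuotientResolution.S1
open Summit.ResolutionOfSingularities.ResolutionOfSingularities.Theorems.WildQuotientResolution.S1.NodeAtlas
open Summit.ResolutionOfSingularities.ResolutionOfSingularities.Theorems.WildQuotientResolution.S1.NpFrame

namespace Summit.ResolutionOfSingularities.ResolutionOfSingularities.Theorems.WildQuotientResolution.S1.GameFrame.GModel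

variable {p : ℕ} {X' X₁ : Scheme.{0}} {q : X' ⟶ X₁} {G : Type} [Group G] {ρ : G →* Aut X'} {g₀ : G}

/-- ★★ **KIRÁLY–LÜTKEBOHMERT AT MOVE 0: PRINCIPAL AUGMENTATION IDEAL ⇒ TERMINAL.** Let `(X′, X₁, q, ρ, g₀)` be action data with `X′` AFFINE,
integral, locally Noetherian, `q` affine and `G`-invariant, `G = ⟨g₀⟩`; let `e : Γ(X′, ⊤) ≃+* A₀` intertwine the action of `g₀` (pull-back along
`g₀⁻¹`) with a ring automorphism `σ₀` of the REGULAR ring `A₀`, of finite type over a Noetherian ring `R₀` fixed by `σ₀`, with `σ₀^[p] = id`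
(`p` prime). If the AUGMENTATION IDEAL of `σ₀` is PRINCIPAL, the initial model is TERMINAL: `A₀^{σ₀}` is Noetherian (E. Noether) and regular
(global Király–Lütkebohmert). [OURS · L1 W4.5c · depth-0 kill; NOT a statement of the manuscript] -/
theorem terminal_initial_of_isPrincipal_augmentationIdeal [Finite G] (hG : ∀ g : G, g ∈ Subgroup.zpowers g₀)
    (hq : ∀ g : G, (ρ g).hom ≫ q = q) [IsIntegral X'] [IsLocallyNoetherian X'] [IsAffine X'] [IsAffineHom q]
    {A₀ : Type} [CommRing A₀] [IsRegularRing A₀] {R₀ : Type} [CommRing R₀] [IsNoetherianRing R₀] [Algebra R₀ A₀] [Algebra.FiniteType R₀ A₀]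
    (σ₀ : A₀ ≃+* A₀) (hσ₀R : ∀ r : R₀, σ₀ (algebraMap R₀ A₀ r) = algebraMap R₀ A₀ r)
    (hp : p.Prime) (hσp : ∀ x : A₀, σ₀^[p] x = x) (hI : (augmentationIdeal σ₀).IsPrincipal)
    (e : Γ(X', ⊤) ≃+* A₀)
    (he : ∀ t : Γ(X', ⊤), e ((ρ g₀⁻¹).hom.appLE ⊤ ⊤ (by rw [Scheme.Hom.preimage_top]) t) = σ₀ (e t))
    (h₀ : NodeAtlas p (⟨ρ, hq⟩ : ActionOver q G) g₀) :
    (GModel.initial (p := p) (g₀ := g₀) hq h₀).Terminal := by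
  haveI : IsNoetherianRing (invariantSubring σ₀) :=
    (InvariantsRegular.exists_finset_closure_of_finiteType σ₀ hσ₀R hp.pos hσp).1
  haveI : IsRegularRing (invariantSubring σ₀) := InvariantsRegular.isRegularRing_invariantSubring σ₀ hp hσp hI
  exact terminal_initial_of_fixedRing_equiv_regular hG hq e (σ₀ : A₀ →+* A₀) (fun t => he t)
    (RingEquiv.refl (invariantSubring σ₀)) h₀

/-- ★ **… hence such a datum inhabits the research stub at depth 0** (every root decoration; ✓`exists_reachLowerF_of_terminal`, the empty tree).
[OURS · L1 W4.5c · depth-0 kill; NOT a statement of the manuscript] -/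
theorem exists_reachLowerF_initial_of_isPrincipal_augmentationIdeal [Finite G] (hG : ∀ g : G, g ∈ Subgroup.zpowers g₀)
    (hq : ∀ g : G, (ρ g).hom ≫ q = q) [IsIntegral X'] [IsLocallyNoetherian X'] [IsAffine X'] [IsAffineHom q]
    {A₀ : Type} [CommRing A₀] [IsRegularRing A₀] {R₀ : Type} [CommRing R₀] [IsNoetherianRing R₀] [Algebra R₀ A₀] [Algebra.FiniteType R₀ A₀]
    (σ₀ : A₀ ≃+* A₀) (hσ₀R : ∀ r : R₀, σ₀ (algebraMap R₀ A₀ r) = algebraMap R₀ A₀ r)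
    (hp : p.Prime) (hσp : ∀ x : A₀, σ₀^[p] x = x) (hI : (augmentationIdeal σ₀).IsPrincipal)
    (e : Γ(X', ⊤) ≃+* A₀)
    (he : ∀ t : Γ(X', ⊤), e ((ρ g₀⁻¹).hom.appLE ⊤ ⊤ (by rw [Scheme.Hom.preimage_top]) t) = σ₀ (e t))
    (h₀ : NodeAtlas p (⟨ρ, hq⟩ : ActionOver q G) g₀) (𝔄₀ : NodeAtlasData p (GModel.initial hq h₀).act g₀) :
    ∃ P : ∀ M : GModel p q G ρ g₀, NodeAtlasData p M.act g₀ → Prop,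
      P (GModel.initial hq h₀) 𝔄₀ ∧ ∀ (M : GModel p q G ρ g₀) (𝔄 : NodeAtlasData p M.act g₀), P M 𝔄 → ¬ M.Terminal →
        ∃ n : ℕ, TreeF P (fun N 𝔅 => LexLTF N 𝔅 M 𝔄) n M 𝔄 :=
  exists_reachLowerF_of_terminal _ 𝔄₀
    (terminal_initial_of_isPrincipal_augmentationIdeal hG hq σ₀ hσ₀R hp hσp hI e he h₀)

/-- **Census coordinates**: `A₀ = k[x_ι]` (`ι` finite), `R₀ = k`, `σ₀` fixing constants, of order dividing `p`, with principal augmentation ideal ⇒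
the initial model is TERMINAL. [OURS · L1 W4.5c · depth-0 kill; NOT a statement of the manuscript] -/
theorem terminal_initial_of_isPrincipal_augmentationIdeal_mvPolynomial [Finite G] (hG : ∀ g : G, g ∈ Subgroup.zpowers g₀)
    (hq : ∀ g : G, (ρ g).hom ≫ q = q) [IsIntegral X'] [IsLocallyNoetherian X'] [IsAffine X'] [IsAffineHom q]
    {k : Type} [Field k] {ι : Type} [Finite ι] (σ : MvPolynomial ι k ≃+* MvPolynomial ι k) (hC : ∀ a : k, σ (C a) = C a)
    (hp : p.Prime) (hσp : ∀ x : MvPolynomial ι k, σ^[p] x = x) (hI : (augmentationIdeal σ).IsPrincipal)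
    (e : Γ(X', ⊤) ≃+* MvPolynomial ι k)
    (he : ∀ t : Γ(X', ⊤), e ((ρ g₀⁻¹).hom.appLE ⊤ ⊤ (by rw [Scheme.Hom.preimage_top]) t) = σ (e t))
    (h₀ : NodeAtlas p (⟨ρ, hq⟩ : ActionOver q G) g₀) :
    (GModel.initial (p := p) (g₀ := g₀) hq h₀).Terminal :=
  terminal_initial_of_isPrincipal_augmentationIdeal (R₀ := k) hG hq σ (fun a => hC a) hp hσp hI e he h₀

/-- **Census coordinates, research-stub form** (every root decoration). [OURS · L1 W4.5c · depth-0 kill; NOT a statement of the manuscript] -/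
theorem exists_reachLowerF_initial_of_isPrincipal_augmentationIdeal_mvPolynomial [Finite G] (hG : ∀ g : G, g ∈ Subgroup.zpowers g₀)
    (hq : ∀ g : G, (ρ g).hom ≫ q = q) [IsIntegral X'] [IsLocallyNoetherian X'] [IsAffine X'] [IsAffineHom q]
    {k : Type} [Field k] {ι : Type} [Finite ι] (σ : MvPolynomial ι k ≃+* MvPolynomial ι k) (hC : ∀ a : k, σ (C a) = C a)
    (hp : p.Prime) (hσp : ∀ x : MvPolynomial ι k, σ^[p] x = x) (hI : (augmentationIdeal σ).IsPrincipal)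
    (e : Γ(X', ⊤) ≃+* MvPolynomial ι k)
    (he : ∀ t : Γ(X', ⊤), e ((ρ g₀⁻¹).hom.appLE ⊤ ⊤ (by rw [Scheme.Hom.preimage_top]) t) = σ (e t))
    (h₀ : NodeAtlas p (⟨ρ, hq⟩ : ActionOver q G) g₀) (𝔄₀ : NodeAtlasData p (GModel.initial hq h₀).act g₀) :
    ∃ P : ∀ M : GModel p q G ρ g₀, NodeAtlasData p M.act g₀ → Prop,
      P (GModel.initial hq h₀) 𝔄₀ ∧ ∀ (M : GModel p q G ρ g₀) (𝔄 : NodeAtlasData p M.act g₀), P M 𝔄 → ¬ M.Terminal →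
        ∃ n : ℕ, TreeF P (fun N 𝔅 => LexLTF N 𝔅 M 𝔄) n M 𝔄 :=
  exists_reachLowerF_of_terminal _ 𝔄₀
    (terminal_initial_of_isPrincipal_augmentationIdeal_mvPolynomial hG hq σ hC hp hσp hI e he h₀)

end Summit.ResolutionOfSingularities.ResolutionOfSingularities.Theorems.WildQuotientResolution.S1.GameFrame.GModel

end
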